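import Literature.AnabelianGeometry.EtaleTheta.ContH1Lemmas
import Mathlib.GroupTheory.SemidirectProduct
import HarnessLib

/-!
# Continuous `H¹`: extending an invariant class along a CYCLIC quotient, I — the construction and the
# infinite cyclic case (support file for [EtTh] §1–§2)

Generic homological algebra for the concrete continuous first cohomology `ContH1 φ A H` of
`ContH1.lean` (continuous crossed homomorphisms `H → A`, `H ≤ G`, with values in an abelian normal
subgroup `A ≤ G'` on which `G` acts by conjugation through `φ : G →* G'`; seat abc-iut-L2-t1).

For `N ≤ H ≤ G` with `N` normal in `H` and `H/N` CYCLIC, generated by the class of `t ∈ H`, the exact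
sequence of low degree of Hochschild–Serre / inflation–restriction
`H¹(H, A) → H¹(N, A)^{H/N} → H²(H/N, A^N)` [cite: NeukirchSchmidtWingberg2008, I §6 Prop 1.6.7]
says that a class of `H¹(N, A)` fixed by `t` comes from `H¹(H, A)` as soon as the transgression
obstruction in `H²(H/N, A^N)` dies.  This file and its sequel `ContH1CyclicExtensionFinite.lean` prove the
two cases in which it dies, EXPLICITLY (at the level of cocycles, the extension pinned down by its value at
`t`), which is the form the abc-iut cell's [EtTh] §2 files consume (seat abc-iut-L2-t7's residual input
"x1" of `XuuCocycleOfCyclotome.lean`: extend a mod-`l` representative of `η̈^Θ` from `Π^tp_Ÿ` to `Π^tp_X̲`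
along quotients that are infinite cyclic resp. of order `2`, the coefficients `Δ_Θ/l·Δ_Θ` having odd
order).  Here:

* `toSemidirect` — a cocycle `f` on `N` IS a homomorphism `n ↦ (f n, n) : N → A ⋊ H` (Mathlib
  `SemidirectProduct`, `H` acting on `A` through `conjAut φ A H`); `toSemidirect_conj_of_inv`,
  `toSemidirect_conj_zpow` — the `t`-INVARIANCE IDENTITY `f(t n t⁻¹) = b · ᵗf(n) · (ᵗⁿᵗ⁻¹b)⁻¹` (i.e.
  `t·f = f·∂b`, `t·[f] = [f]`) says `(b,t)` conjugates this homomorphism into itself, hence so does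
  `(b,t)^k`, `k ∈ ℤ`;
* `exists_contCocycle_extension_core` — the construction `h ↦ s_f(h t^{-κ(h)}) · (b,t)^{κ(h)}` for an
  exponent function `κ : H → ℤ`, its multiplicativity, and the continuity of its `A`-component;
* `exists_contCocycle_extension_of_int` — **`H/N ≅ ℤ`** (a character `χ : H → ℤ` with kernel `N`,
  `χ(t) = 1`): EVERY cocycle on `N` whose class is `t`-invariant (witness `b`) extends to a cocycle `F`
  on `H` with `F|_N = f` and `F(t) = b` — `H²(ℤ, −) = 0`.

The finite cyclic case (norm condition; automatic when `x ↦ x^m` is bijective on `A`) is in the sequel.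
Hypotheses beyond `ContH1.lean`'s: `Continuous φ` and `N` OPEN in `G` (continuity of the extension).
Classical ([cite: NeukirchSchmidtWingberg2008, I §6 Prop 1.6.7], [cite: SerreGaloisCohomology1997, I §2.6 (b)]);
no anabelian content; nothing of [EtTh] is asserted. Seat abc-iut-w5-d234 (wave-5 prover), for the L2
residual "x1" named by abc-iut-L2-t7 (HOME/HANDOFF.md §abc-iut-L2-t7).
-/

namespace Literature.AnabelianGeometry.EtaleTheta

namespace ContH1

open scoped IsMulCommutative

variable {G G' : Type*} [Group G] [TopologicalSpace G]
  [Group G'] [TopologicalSpace G'] [IsTopologicalGroup G']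
  {φ : G →* G'} {A : Subgroup G'} [A.Normal] [IsMulCommutative A]
  {N H : Subgroup G}

/-! ### The semidirect product bookkeeping -/

/-- The action of `H` on `A` by conjugation through `φ`, as a homomorphism to `MulAut A` (the structure
map of the semidirect product `A ⋊ H` used for the bookkeeping). [cite: NeukirchSchmidtWingberg2008, I §6 Prop 1.6.7] -/
abbrev conjAut (φ : G →* G') (A : Subgroup G') [A.Normal] (H : Subgroup G) : ↥H →* MulAut ↥A :=
  MulAut.conjNormal.comp (φ.comp H.subtype)

omit [TopologicalSpace G] [TopologicalSpace G'] [IsTopologicalGroup G'] [IsMulCommutative A] in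
/-- `conjAut φ A H h` is conjugation by `φ(h)` on `A`. [cite: NeukirchSchmidtWingberg2008, I §2 and II §7] -/
theorem conjAut_apply (h : ↥H) (a : ↥A) : conjAut φ A H h a = MulAut.conjNormal (φ (h : G)) a := rfl

/-- A cocycle `f` on `N ≤ H` as a homomorphism `n ↦ (f n, n) : N → A ⋊ H`.
[cite: NeukirchSchmidtWingberg2008, I §6 Prop 1.6.7] -/
def toSemidirect (hNH : N ≤ H) (f : contCocycles φ A N) : ↥N →* (↥A ⋊[conjAut φ A H] ↥H) where
  toFun n := ⟨f.1 n, ⟨(n : G), hNH n.2⟩⟩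
  map_one' := by
    ext
    · simp [cocycle_map_one f]
    · simp
  map_mul' n n' := by
    ext
    · simp only [SemidirectProduct.mul_left, conjAut_apply]
      exact congrArg Subtype.val (f.2.2 n n')
    · simp

/-- First component of `toSemidirect`: the cocycle. [cite: NeukirchSchmidtWingberg2008, I §2 and II §7] -/
@[simp] theorem toSemidirect_left (hNH : N ≤ H) (f : contCocycles φ A N) (n : ↥N) :
    (toSemidirect hNH f n).left = f.1 n := rfl

/-- Second component of `toSemidirect`: the inclusion `N ≤ H`. [cite: NeukirchSchmidtWingberg2008, I §2 and II §7] -/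
@[simp] theorem toSemidirect_right (hNH : N ≤ H) (f : contCocycles φ A N) (n : ↥N) :
    (toSemidirect hNH f n).right = ⟨(n : G), hNH n.2⟩ := rfl

/-! ### The invariance identity and its propagation to powers of `t` -/

section Compat

variable (hNH : N ≤ H) (hN : ∀ h ∈ H, ∀ n ∈ N, h * n * h⁻¹ ∈ N) {t : G} (ht : t ∈ H)
  (f : contCocycles φ A N) (b : ↥A)

/-- The `t`-INVARIANCE IDENTITY of the class of `f` with witness `b` — `f(t n t⁻¹) = b · ᵗf(n) · (ᵗⁿᵗ⁻¹b)⁻¹`,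
i.e. `t·[f] = [f]` in `H¹(N, A)` with `t·f = f · ∂b` — says precisely that `(b, t) ∈ A ⋊ H` conjugates the
homomorphism `n ↦ (f n, n)` into itself over `n ↦ t n t⁻¹`. [cite: NeukirchSchmidtWingberg2008, I §6 Prop 1.6.7] -/
theorem toSemidirect_conj_of_inv
    (hinv : ∀ n : ↥N, f.1 ⟨t * n * t⁻¹, hN t ht n n.2⟩ =
      b * MulAut.conjNormal (φ t) (f.1 n) * (MulAut.conjNormal (φ (t * n * t⁻¹)) b)⁻¹)
    (n : ↥N) :
    toSemidirect hNH f ⟨t * n * t⁻¹, hN t ht n n.2⟩ =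
      (⟨b, ⟨t, ht⟩⟩ : ↥A ⋊[conjAut φ A H] ↥H) * toSemidirect hNH f n * (⟨b, ⟨t, ht⟩⟩)⁻¹ := by
  ext
  · simp only [toSemidirect_left, SemidirectProduct.mul_left, SemidirectProduct.inv_left,
      SemidirectProduct.mul_right, toSemidirect_right, hinv n]
    simp only [conjAut_apply, Subgroup.coe_mul, Subgroup.coe_inv, MulAut.conjNormal_apply]
    simp only [map_mul, map_inv]
    group
  · simp only [toSemidirect_right, SemidirectProduct.mul_right, SemidirectProduct.inv_right,
      Subgroup.coe_mul, Subgroup.coe_inv, Subgroup.coe_mk]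

/-- Propagation to natural powers: `s_f(t^k n t^{-k}) = (b,t)^k s_f(n) (b,t)^{-k}`.
[cite: NeukirchSchmidtWingberg2008, I §6 Prop 1.6.7] -/
theorem toSemidirect_conj_pow
    (hI : ∀ n : ↥N, toSemidirect hNH f ⟨t * n * t⁻¹, hN t ht n n.2⟩ =
      (⟨b, ⟨t, ht⟩⟩ : ↥A ⋊[conjAut φ A H] ↥H) * toSemidirect hNH f n * (⟨b, ⟨t, ht⟩⟩)⁻¹)
    (k : ℕ) (n : G) (hn : n ∈ N) :
    toSemidirect hNH f ⟨t ^ k * n * (t ^ k)⁻¹, hN _ (Subgroup.pow_mem H ht k) n hn⟩ =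
      (⟨b, ⟨t, ht⟩⟩ : ↥A ⋊[conjAut φ A H] ↥H) ^ k * toSemidirect hNH f ⟨n, hn⟩ *
        ((⟨b, ⟨t, ht⟩⟩ : ↥A ⋊[conjAut φ A H] ↥H) ^ k)⁻¹ := by
  induction k with
  | zero =>
    have h1 : (⟨t ^ 0 * n * (t ^ 0)⁻¹, hN _ (Subgroup.pow_mem H ht 0) n hn⟩ : ↥N) = ⟨n, hn⟩ :=
      Subtype.ext (by simp)
    rw [h1, pow_zero, one_mul, inv_one, mul_one]
  | succ k ih =>
    have hmem : t ^ k * n * (t ^ k)⁻¹ ∈ N := hN _ (Subgroup.pow_mem H ht k) n hn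
    have h1 : (⟨t ^ (k + 1) * n * (t ^ (k + 1))⁻¹, hN _ (Subgroup.pow_mem H ht (k + 1)) n hn⟩ : ↥N) =
        ⟨t * (t ^ k * n * (t ^ k)⁻¹) * t⁻¹, hN t ht _ hmem⟩ :=
      Subtype.ext (by simp only [pow_succ']; group)
    rw [h1, hI ⟨_, hmem⟩, ih, pow_succ']
    group

/-- Propagation to all integer powers: `s_f(t^k n t^{-k}) = (b,t)^k s_f(n) (b,t)^{-k}`, `k ∈ ℤ`.
[cite: NeukirchSchmidtWingberg2008, I §6 Prop 1.6.7] -/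
theorem toSemidirect_conj_zpow
    (hI : ∀ n : ↥N, toSemidirect hNH f ⟨t * n * t⁻¹, hN t ht n n.2⟩ =
      (⟨b, ⟨t, ht⟩⟩ : ↥A ⋊[conjAut φ A H] ↥H) * toSemidirect hNH f n * (⟨b, ⟨t, ht⟩⟩)⁻¹)
    (k : ℤ) (n : G) (hn : n ∈ N) :
    toSemidirect hNH f ⟨t ^ k * n * (t ^ k)⁻¹, hN _ (Subgroup.zpow_mem H ht k) n hn⟩ =
      (⟨b, ⟨t, ht⟩⟩ : ↥A ⋊[conjAut φ A H] ↥H) ^ k * toSemidirect hNH f ⟨n, hn⟩ *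
        ((⟨b, ⟨t, ht⟩⟩ : ↥A ⋊[conjAut φ A H] ↥H) ^ k)⁻¹ := by
  obtain ⟨k, rfl | rfl⟩ := k.eq_nat_or_neg
  · have h1 : (⟨t ^ (k : ℤ) * n * (t ^ (k : ℤ))⁻¹, hN _ (Subgroup.zpow_mem H ht k) n hn⟩ : ↥N) =
        ⟨t ^ k * n * (t ^ k)⁻¹, hN _ (Subgroup.pow_mem H ht k) n hn⟩ :=
      Subtype.ext (by simp only [zpow_natCast])
    rw [h1, toSemidirect_conj_pow hNH hN ht f b hI k n hn, zpow_natCast]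
  · -- negative powers: apply the positive case to `n' := t^{-k} n t^{k}`
    have hmem : t ^ (-(k : ℤ)) * n * (t ^ (-(k : ℤ)))⁻¹ ∈ N := hN _ (Subgroup.zpow_mem H ht _) n hn
    have key := toSemidirect_conj_pow hNH hN ht f b hI k _ hmem
    have h1 : (⟨t ^ k * (t ^ (-(k : ℤ)) * n * (t ^ (-(k : ℤ)))⁻¹) * (t ^ k)⁻¹,
        hN _ (Subgroup.pow_mem H ht k) _ hmem⟩ : ↥N) = ⟨n, hn⟩ :=
      Subtype.ext (by simp only [zpow_neg, zpow_natCast]; group)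
    rw [h1] at key
    rw [key]
    group

end Compat

/-! ### The core construction -/

section Core

variable [IsTopologicalGroup G]

omit [IsTopologicalGroup G] in
open Classical in
/-- A dependent `if` glueing a continuous function on an OPEN subgroup `N ≤ G` to a constant off `N` is
continuous at the points of `N`. [folklore] -/
private theorem continuousAt_dite_of_isOpen (hNopen : IsOpen (N : Set G)) {Y : Type*} [TopologicalSpace Y]
    (g : ↥N → Y) (hg : Continuous g) (y : Y) {g₀ : G} (hg₀ : g₀ ∈ N) :
    ContinuousAt (fun x : G => if hx : x ∈ N then g ⟨x, hx⟩ else y) g₀ := by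
  have hemb := hNopen.isOpenEmbedding_subtypeVal
  have hcomp : Continuous ((fun x : G => if hx : x ∈ N then g ⟨x, hx⟩ else y) ∘
      ((↑) : ↥(N : Set G) → G)) := by
    have heq : ((fun x : G => if hx : x ∈ N then g ⟨x, hx⟩ else y) ∘ ((↑) : ↥(N : Set G) → G)) =
        fun n : ↥(N : Set G) => g ⟨n.1, n.2⟩ := by
      funext n
      exact dif_pos n.2
    rw [heq]
    exact hg.comp (continuous_subtype_val.subtype_mk _)
  exact (hemb.continuousAt_iff (x := (⟨g₀, hg₀⟩ : ↥(N : Set G)))).mp hcomp.continuousAt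

open Classical in
/-- **Core of the extension** (technical; the two user-facing cases below and in
`ContH1CyclicExtensionFinite.lean` instantiate it): given the semidirect-product form `hI` of the `t`-invariance
identity, an "exponent" function `κ : H → ℤ` with `h · t^{-κ(h)} ∈ N`, constant on `N`-cosets, whose
additivity defect `e = κ(h) + κ(h') − κ(hh')` always satisfies `s_f(t^e) = (b,t)^e`, the map
`h ↦ s_f(h t^{-κ h}) · (b,t)^{κ h}` is a homomorphism `H → A ⋊ H` over the identity of `H`, and its
`A`-component is the sought continuous cocycle. [cite: NeukirchSchmidtWingberg2008, I §6 Prop 1.6.7] -/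
theorem exists_contCocycle_extension_core (hφ : Continuous φ) (hNopen : IsOpen (N : Set G))
    (hNH : N ≤ H) (hN : ∀ h ∈ H, ∀ n ∈ N, h * n * h⁻¹ ∈ N) {t : G} (ht : t ∈ H)
    (f : contCocycles φ A N) (b : ↥A)
    (hI : ∀ n : ↥N, toSemidirect hNH f ⟨t * n * t⁻¹, hN t ht n n.2⟩ =
      (⟨b, ⟨t, ht⟩⟩ : ↥A ⋊[conjAut φ A H] ↥H) * toSemidirect hNH f n * (⟨b, ⟨t, ht⟩⟩)⁻¹)
    (κ : ↥H → ℤ) (hκN : ∀ h : ↥H, (h : G) * t ^ (-κ h) ∈ N)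
    (hκ : ∀ h h' : ↥H, (h' : G) * (h : G)⁻¹ ∈ N → κ h' = κ h)
    (hκmul : ∀ h h' : ↥H, ∃ he : t ^ (κ h + κ h' - κ (h * h')) ∈ N,
      toSemidirect hNH f ⟨_, he⟩ =
        (⟨b, ⟨t, ht⟩⟩ : ↥A ⋊[conjAut φ A H] ↥H) ^ (κ h + κ h' - κ (h * h')))
    (hκt : (toSemidirect hNH f ⟨t * t ^ (-κ ⟨t, ht⟩), hκN ⟨t, ht⟩⟩ *
      (⟨b, ⟨t, ht⟩⟩ : ↥A ⋊[conjAut φ A H] ↥H) ^ κ ⟨t, ht⟩).left = b) :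
    ∃ F : contCocycles φ A H, (∀ n : ↥N, F.1 ⟨n, hNH n.2⟩ = f.1 n) ∧ F.1 ⟨t, ht⟩ = b := by
  set x : ↥A ⋊[conjAut φ A H] ↥H := ⟨b, ⟨t, ht⟩⟩ with hx
  set sN := toSemidirect hNH f with hsN
  -- the candidate homomorphism `S : H → A ⋊ H`
  set S : ↥H → ↥A ⋊[conjAut φ A H] ↥H := fun h => sN ⟨(h : G) * t ^ (-κ h), hκN h⟩ * x ^ κ h
    with hS
  have right_zpow : ∀ k : ℤ, (x ^ k).right = ⟨t, ht⟩ ^ k := fun k => by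
    change SemidirectProduct.rightHom (x ^ k) = _
    rw [map_zpow]
    rfl
  -- `S` lies over the identity of `H`
  have S_right : ∀ h, (S h).right = h := by
    intro h
    simp only [hS, SemidirectProduct.mul_right, hsN, toSemidirect_right, right_zpow]
    apply Subtype.ext
    simp only [Subgroup.coe_mul, SubgroupClass.coe_zpow]
    group
  -- `S` is multiplicative
  have S_mul : ∀ h h' : ↥H, S (h * h') = S h * S h' := by
    intro h h'
    obtain ⟨he, hsNe⟩ := hκmul h h'
    -- the common value `s_f(m₁) · x^(κ h + κ h')`, `m₁ = h h' t^{-κ h'} t^{-κ h}`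
    have hm₂ : t ^ κ h * ((h' : G) * t ^ (-κ h')) * (t ^ κ h)⁻¹ ∈ N :=
      hN _ (Subgroup.zpow_mem H ht _) _ (hκN h')
    have hm₁ : (h : G) * t ^ (-κ h) * (t ^ κ h * ((h' : G) * t ^ (-κ h')) * (t ^ κ h)⁻¹) ∈ N :=
      N.mul_mem (hκN h) hm₂
    have A2 : x ^ κ h * sN ⟨(h' : G) * t ^ (-κ h'), hκN h'⟩ * (x ^ κ h)⁻¹ = sN ⟨_, hm₂⟩ :=
      (toSemidirect_conj_zpow hNH hN ht f b hI (κ h) _ (hκN h')).symm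
    have lhs : S h * S h' = sN ⟨_, hm₁⟩ * x ^ (κ h + κ h') := by
      simp only [hS]
      calc sN ⟨(h : G) * t ^ (-κ h), hκN h⟩ * x ^ κ h * (sN ⟨(h' : G) * t ^ (-κ h'), hκN h'⟩ * x ^ κ h')
          = sN ⟨(h : G) * t ^ (-κ h), hκN h⟩ *
              (x ^ κ h * sN ⟨(h' : G) * t ^ (-κ h'), hκN h'⟩ * (x ^ κ h)⁻¹) * (x ^ κ h * x ^ κ h') := by
            group
        _ = sN ⟨_, hm₁⟩ * x ^ (κ h + κ h') := by
            rw [A2, ← map_mul, zpow_add]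
            rfl
    have hsplit : (⟨((h * h' : ↥H) : G) * t ^ (-κ (h * h')), hκN (h * h')⟩ : ↥N) =
        ⟨_, hm₁⟩ * ⟨_, he⟩ := by
      apply Subtype.ext
      simp only [Subgroup.coe_mul]
      rw [show -κ (h * h') = (-κ h' + -κ h) + (κ h + κ h' - κ (h * h')) by ring, zpow_add, zpow_add]
      group
    have rhs : S (h * h') = sN ⟨_, hm₁⟩ * x ^ (κ h + κ h') := by
      simp only [hS]
      rw [hsplit, map_mul, hsNe, mul_assoc, ← zpow_add]
      congr 2
      ring
    rw [lhs, rhs]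
  -- hence a group homomorphism
  let Shom : ↥H →* ↥A ⋊[conjAut φ A H] ↥H := MonoidHom.mk' S S_mul
  -- the cocycle
  set F : ↥H → ↥A := fun h => (S h).left with hF
  have F_cocycle : ∀ g h : ↥H, F (g * h) = F g * MulAut.conjNormal (φ (g : G)) (F h) := by
    intro g h
    simp only [hF]
    rw [S_mul, SemidirectProduct.mul_left, S_right, conjAut_apply]
  -- `F` restricts to `f`
  have S_one : S 1 = 1 := Shom.map_one
  have F_N : ∀ n : ↥N, F ⟨n, hNH n.2⟩ = f.1 n := by
    intro n
    have hk : κ ⟨n, hNH n.2⟩ = κ 1 := hκ 1 ⟨n, hNH n.2⟩ (by simp)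
    have ht1 : t ^ (-κ 1) ∈ N := by simpa using hκN 1
    have hsplit : (⟨((⟨n, hNH n.2⟩ : ↥H) : G) * t ^ (-κ ⟨n, hNH n.2⟩), hκN ⟨n, hNH n.2⟩⟩ : ↥N) =
        n * ⟨t ^ (-κ 1), ht1⟩ := Subtype.ext (by simp [hk])
    have h1 : (⟨((1 : ↥H) : G) * t ^ (-κ 1), hκN 1⟩ : ↥N) = ⟨t ^ (-κ 1), ht1⟩ := Subtype.ext (by simp)
    have hS1 : sN ⟨t ^ (-κ 1), ht1⟩ * x ^ κ 1 = 1 := by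
      rw [← h1]; exact S_one
    simp only [hF, hS]
    rw [hsplit, map_mul, hk, mul_assoc, hS1, mul_one, hsN, toSemidirect_left]
  -- value at `t`
  have F_t : F ⟨t, ht⟩ = b := hκt
  -- continuity
  have F_cont : Continuous F := by
    rw [continuous_induced_rng, continuous_iff_continuousAt]
    intro h₀
    have hU : IsOpen {h : ↥H | (h : G) * (h₀ : G)⁻¹ ∈ N} :=
      hNopen.preimage (show Continuous fun h : ↥H => (h : G) * (h₀ : G)⁻¹ from
        continuous_subtype_val.mul continuous_const)
    have hU₀ : (h₀ : G) * (h₀ : G)⁻¹ ∈ N := by rw [mul_inv_cancel]; exact N.one_mem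
    -- local formula on `U`
    have hloc : ∀ (h : ↥H) (hh : (h : G) * (h₀ : G)⁻¹ ∈ N),
        F h = f.1 ⟨_, hh⟩ * MulAut.conjNormal (φ ((h : G) * (h₀ : G)⁻¹)) (F h₀) := by
      intro h hh
      have hsplit : h = ⟨(h : G) * (h₀ : G)⁻¹, hNH hh⟩ * h₀ := Subtype.ext (by simp)
      conv_lhs => rw [hsplit]
      rw [F_cocycle, F_N ⟨_, hh⟩]
    -- the local function and its continuity at `h₀`
    let fval : G → G' := fun g => if hg : g ∈ N then ((f.1 ⟨g, hg⟩ : ↥A) : G') else 1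
    have hmulc : Continuous fun h : ↥H => (h : G) * (h₀ : G)⁻¹ :=
      continuous_subtype_val.mul continuous_const
    have hfval : ContinuousAt (fun h : ↥H => fval ((h : G) * (h₀ : G)⁻¹)) h₀ :=
      ContinuousAt.comp (f := fun h : ↥H => (h : G) * (h₀ : G)⁻¹) (x := h₀)
        (continuousAt_dite_of_isOpen hNopen (fun n => ((f.1 n : ↥A) : G'))
          (continuous_subtype_val.comp f.2.1) 1 hU₀) hmulc.continuousAt
    have hconj : Continuous fun h : ↥H =>
        φ ((h : G) * (h₀ : G)⁻¹) * ((F h₀ : ↥A) : G') * (φ ((h : G) * (h₀ : G)⁻¹))⁻¹ := by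
      fun_prop
    refine (hfval.mul hconj.continuousAt).congr (Filter.eventuallyEq_of_mem (hU.mem_nhds hU₀) ?_)
    intro h hh
    simp only [Set.mem_setOf_eq] at hh
    simp only [Pi.mul_apply, Function.comp_apply, hloc h hh, Subgroup.coe_mul, MulAut.conjNormal_apply, fval,
      dif_pos hh]
  exact ⟨⟨F, F_cont, F_cocycle⟩, F_N, F_t⟩

/-! ### Infinite cyclic quotient: `H²(ℤ, −) = 0` -/

omit [TopologicalSpace G] [IsTopologicalGroup G] in
/-- If `N ≤ H` is the kernel of a homomorphism out of `H`, then `N` is normal in `H`. [folklore] -/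
private theorem conj_mem_of_ker {Q : Type*} [Group Q] (hNH : N ≤ H) (χ : ↥H →* Q)
    (hker : ∀ h : ↥H, χ h = 1 ↔ (h : G) ∈ N) : ∀ h ∈ H, ∀ n ∈ N, h * n * h⁻¹ ∈ N := by
  intro h hh n hn
  have h1 : χ ⟨n, hNH hn⟩ = 1 := (hker ⟨n, hNH hn⟩).2 hn
  have h2 : χ (⟨h, hh⟩ * ⟨n, hNH hn⟩ * (⟨h, hh⟩)⁻¹) = 1 := by
    rw [map_mul, map_mul, map_inv, h1, mul_one, mul_inv_cancel]
  exact (hker _).1 h2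

/-- **Extending a `t`-invariant class along an INFINITE CYCLIC quotient.**  Let `N ≤ H ≤ G` with `N`
open in `G`, let `χ : H → ℤ` be a homomorphism with kernel `N` and `t ∈ H` with `χ(t) = 1` (so
`H/N ≅ ℤ` generated by `t`), and let `f` be a continuous cocycle on `N` (coefficients `A`, action by
conjugation through the continuous `φ`) whose class is `t`-invariant, with witness `b ∈ A`:
`f(t n t⁻¹) = b · ᵗf(n) · (ᵗⁿᵗ⁻¹b)⁻¹` for all `n ∈ N` (i.e. `t·f = f·∂b`).  Then `f` EXTENDS to a continuous
cocycle `F` on `H` with `F|_N = f` and `F(t) = b`.  (The obstruction to extending lives in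
`H²(H/N, A^N) = H²(ℤ, A^N) = 0`.) [cite: NeukirchSchmidtWingberg2008, I §6 Prop 1.6.7] -/
theorem exists_contCocycle_extension_of_int (hφ : Continuous φ) (hNopen : IsOpen (N : Set G))
    (hNH : N ≤ H) (χ : ↥H →* Multiplicative ℤ) (hker : ∀ h : ↥H, χ h = 1 ↔ (h : G) ∈ N)
    {t : G} (ht : t ∈ H) (hχt : χ ⟨t, ht⟩ = Multiplicative.ofAdd 1)
    (f : contCocycles φ A N) (b : ↥A)
    (hinv : ∀ (n : G) (hn : n ∈ N) (htn : t * n * t⁻¹ ∈ N), f.1 ⟨t * n * t⁻¹, htn⟩ =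
      b * MulAut.conjNormal (φ t) (f.1 ⟨n, hn⟩) * (MulAut.conjNormal (φ (t * n * t⁻¹)) b)⁻¹) :
    ∃ F : contCocycles φ A H, (∀ n : ↥N, F.1 ⟨n, hNH n.2⟩ = f.1 n) ∧ F.1 ⟨t, ht⟩ = b := by
  have hN : ∀ h ∈ H, ∀ n ∈ N, h * n * h⁻¹ ∈ N := conj_mem_of_ker hNH χ hker
  have hI := toSemidirect_conj_of_inv hNH hN ht f b (fun n => hinv n n.2 _)
  set x : ↥A ⋊[conjAut φ A H] ↥H := ⟨b, ⟨t, ht⟩⟩ with hx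
  -- the exponent function
  let κ : ↥H → ℤ := fun h => Multiplicative.toAdd (χ h)
  have hχzpow : ∀ k : ℤ, χ (⟨t, ht⟩ ^ k) = Multiplicative.ofAdd k := fun k => by
    rw [map_zpow, hχt, ← ofAdd_zsmul, smul_eq_mul, mul_one]
  have hκN : ∀ h : ↥H, (h : G) * t ^ (-κ h) ∈ N := by
    intro h
    have hmem : (h : G) * t ^ (-κ h) ∈ H := H.mul_mem h.2 (H.zpow_mem ht _)
    have heq : (⟨(h : G) * t ^ (-κ h), hmem⟩ : ↥H) = h * ⟨t, ht⟩ ^ (-κ h) :=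
      Subtype.ext (by simp only [Subgroup.coe_mul, SubgroupClass.coe_zpow])
    have h1 : χ ⟨(h : G) * t ^ (-κ h), hmem⟩ = 1 := by
      rw [heq, map_mul, hχzpow]
      apply Multiplicative.toAdd.injective
      simp [κ]
    exact (hker _).1 h1
  have hκ : ∀ h h' : ↥H, (h' : G) * (h : G)⁻¹ ∈ N → κ h' = κ h := by
    intro h h' hm
    have h1 : χ (h' * h⁻¹) = 1 := (hker (h' * h⁻¹)).2 (by simpa using hm)
    rw [map_mul, map_inv, mul_inv_eq_one] at h1
    simp only [κ, h1]
  have hκmul : ∀ h h' : ↥H, ∃ he : t ^ (κ h + κ h' - κ (h * h')) ∈ N,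
      toSemidirect hNH f ⟨_, he⟩ = x ^ (κ h + κ h' - κ (h * h')) := by
    intro h h'
    have he0 : κ h + κ h' - κ (h * h') = 0 := by simp [κ, map_mul, toAdd_mul]
    have key : ∀ e : ℤ, e = 0 → ∃ he : t ^ e ∈ N, toSemidirect hNH f ⟨t ^ e, he⟩ = x ^ e := by
      rintro e rfl
      refine ⟨by simp, ?_⟩
      have h1 : (⟨t ^ (0 : ℤ), by simp⟩ : ↥N) = 1 := Subtype.ext (by simp)
      rw [h1, map_one, zpow_zero]
    exact key _ he0
  have hκt1 : κ ⟨t, ht⟩ = 1 := by simp [κ, hχt]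
  have hκt : (toSemidirect hNH f ⟨t * t ^ (-κ ⟨t, ht⟩), hκN ⟨t, ht⟩⟩ * x ^ κ ⟨t, ht⟩).left = b := by
    have key : ∀ (k : ℤ), k = 1 → ∀ hm : t * t ^ (-k) ∈ N,
        (toSemidirect hNH f ⟨t * t ^ (-k), hm⟩ * x ^ k).left = b := by
      rintro k rfl hm
      have h1 : (⟨t * t ^ (-(1 : ℤ)), hm⟩ : ↥N) = 1 := Subtype.ext (by simp)
      rw [h1, map_one, one_mul, zpow_one]
    exact key _ hκt1 _
  exact exists_contCocycle_extension_core hφ hNopen hNH hN ht f b hI κ hκN hκ hκmul hκt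

end Core

end ContH1

end Literature.AnabelianGeometry.EtaleTheta
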